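import Summits.Ventures.DiscreteObjects.PP12.ElationLift
import Summits.Ventures.DiscreteObjects.PP12.LiftedPlane

/-!
# A liftable STD_p[n;n/p] lifts to a projective plane of order n with an elation of order p (kernel; general prime)
Framing: lottery ticket; floor = certified bounds/negative ranges.

Cell pub-namedobj (venture DiscreteObjects), target (M), designs gen 9.  The `ZMod p` version of `LiftedPlane`: from
`π : IncArray n u` with `IsSTD p π` and a voltage `φ` with `STD.LiftableZp π φ` (`ElationLift`), `2 ≤ n`, `0 < u`, `p ≠ 0`, a Mathlib
`Configuration.ProjectivePlane` on `ZpLift.LPt π φ` / `ZpLift.LLn π φ` (sheets `s : ZMod p`; `aff i a s ∈ aff j b t ↔ π i j a = b ∧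
φ i a j = s - t`) of order `n` is BUILT (`liftedPlane`, `order_liftedPlane`); the sheet shift `s ↦ s + 1` is an elation `shift`
(axis `axis`, centre `ctr`, `shift ≠ 1`, `shift ^ p = 1`).  Two lifted points of different classes are joined because the `p`
differences `φ(X,B) - φ(Y,B)` over the `p` common blocks are distinct, hence exhaust `ZMod p` (`exists_common_block`).  With
`exists_liftableZp_of_elation` (PP(12), `p = 3`): **`noElationOrder3_iff_noLiftableSTD3 : NoElationOrder3Order12 ↔
NoLiftableSTD3_12_4`** — 'no projective plane of order 12 has an elation of order 3' (in print: Janko–van Trung 1981; not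
re-derived here) IS the finite statement 'no `IncArray 12 4` with `IsSTD 3` admits a `ZMod 3` voltage solving the lift system'
(typed, NOT decided): the route to re-derive that published exclusion slice by enumeration.  Formalisation ours; no `sorry`.
-/

namespace Summit.Ventures.DiscreteObjects.PP12

open Configuration Finset Summit.Ventures.DiscreteObjects.STD

namespace ZpLift

section Lift

variable {n u p : ℕ}

/-- points of the `p`-fold lift -/
inductive LPt (π : IncArray n u) (φ : Fin n → Fin u → Fin n → ZMod p) : Type
  | aff (i : Fin n) (a : Fin u) (s : ZMod p)
  | ax (j : Fin n)
  | ctr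
  deriving DecidableEq

/-- lines of the `p`-fold lift -/
inductive LLn (π : IncArray n u) (φ : Fin n → Fin u → Fin n → ZMod p) : Type
  | aff (j : Fin n) (b : Fin u) (t : ZMod p)
  | cls (i : Fin n)
  | axis
  deriving DecidableEq

variable {π : IncArray n u} {φ : Fin n → Fin u → Fin n → ZMod p}

/-- incidence of the lift -/
def LPt.Inc : LPt π φ → LLn π φ → Prop
  | .aff i a s, .aff j b t => π i j a = b ∧ φ i a j = s - t
  | .aff i _ _, .cls i' => i = i'
  | .aff _ _ _, .axis => False
  | .ax j, .aff j' _ _ => j = j'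
  | .ax _, .cls _ => False
  | .ax _, .axis => True
  | .ctr, .aff _ _ _ => False
  | .ctr, .cls _ => True
  | .ctr, .axis => True

/-- incidence as membership -/
instance : Membership (LPt π φ) (LLn π φ) := ⟨fun m x => LPt.Inc x m⟩
/-- affine point on lifted block -/
@[simp] theorem aff_mem_aff {i : Fin n} {a : Fin u} {s : ZMod p} {j : Fin n} {b : Fin u} {t : ZMod p} :
    (LPt.aff i a s : LPt π φ) ∈ (LLn.aff j b t : LLn π φ) ↔ π i j a = b ∧ φ i a j = s - t := Iff.rfl
/-- affine point on class line -/
@[simp] theorem aff_mem_cls {i : Fin n} {a : Fin u} {s : ZMod p} {i' : Fin n} :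
    (LPt.aff i a s : LPt π φ) ∈ (LLn.cls i' : LLn π φ) ↔ i = i' := Iff.rfl
/-- affine points are off the axis -/
@[simp] theorem aff_mem_axis {i : Fin n} {a : Fin u} {s : ZMod p} :
    (LPt.aff i a s : LPt π φ) ∈ (LLn.axis : LLn π φ) ↔ False := Iff.rfl
/-- axis point on lifted block -/
@[simp] theorem ax_mem_aff {j j' : Fin n} {b : Fin u} {t : ZMod p} :
    (LPt.ax j : LPt π φ) ∈ (LLn.aff j' b t : LLn π φ) ↔ j = j' := Iff.rfl
/-- axis points are off the class lines -/
@[simp] theorem ax_mem_cls {j i : Fin n} : (LPt.ax j : LPt π φ) ∈ (LLn.cls i : LLn π φ) ↔ False := Iff.rfl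
/-- axis points are on the axis -/
@[simp] theorem ax_mem_axis {j : Fin n} : (LPt.ax j : LPt π φ) ∈ (LLn.axis : LLn π φ) ↔ True := Iff.rfl
/-- the centre is off the lifted blocks -/
@[simp] theorem ctr_mem_aff {j : Fin n} {b : Fin u} {t : ZMod p} :
    (LPt.ctr : LPt π φ) ∈ (LLn.aff j b t : LLn π φ) ↔ False := Iff.rfl
/-- the centre is on every class line -/
@[simp] theorem ctr_mem_cls {i : Fin n} : (LPt.ctr : LPt π φ) ∈ (LLn.cls i : LLn π φ) ↔ True := Iff.rfl
/-- the centre is on the axis -/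
@[simp] theorem ctr_mem_axis : (LPt.ctr : LPt π φ) ∈ (LLn.axis : LLn π φ) ↔ True := Iff.rfl

/-- case of `eq_or_eq_lift`: four affine objects -/
theorem eq_or_eq_aaaa (hφ : LiftableZp π φ) {i i' j j' : Fin n} {a a' b b' : Fin u} {s s' t t' : ZMod p}
    (h1 : π i j a = b ∧ φ i a j = s - t) (h2 : π i' j a' = b ∧ φ i' a' j = s' - t)
    (h3 : π i j' a = b' ∧ φ i a j' = s - t') (h4 : π i' j' a' = b' ∧ φ i' a' j' = s' - t') :
    (LPt.aff i a s : LPt π φ) = LPt.aff i' a' s' ∨ (LLn.aff j b t : LLn π φ) = LLn.aff j' b' t' := by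
  by_cases hii' : i = i'
  · subst hii'
    left
    have haa : a = a' := (π _ _).injective (h1.1.trans h2.1.symm)
    subst haa
    rw [sub_left_inj.mp (h1.2.symm.trans h2.2)]
  · right
    by_cases hjj : j = j'
    · subst hjj
      rw [h1.1.symm.trans h3.1, sub_right_inj.mp (h1.2.symm.trans h3.2)]
    · exfalso
      refine hφ.1 i i' hii' a a' j j' hjj (h1.1.trans h2.1.symm) (h3.1.trans h4.1.symm) ?_
      rw [h1.2, h2.2, h3.2, h4.2]; ring

/-- case: two affine points on an affine line and a class line -/
theorem eq_or_eq_aaac {i i' j i₀ : Fin n} {a a' b : Fin u} {s s' t : ZMod p}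
    (h1 : π i j a = b ∧ φ i a j = s - t) (h2 : π i' j a' = b ∧ φ i' a' j = s' - t) (h3 : i = i₀) (h4 : i' = i₀) :
    (LPt.aff i a s : LPt π φ) = LPt.aff i' a' s' ∨ (LLn.aff j b t : LLn π φ) = LLn.cls i₀ := by
  subst h3; subst h4
  left
  have haa : a = a' := (π _ _).injective (h1.1.trans h2.1.symm)
  subst haa
  rw [sub_left_inj.mp (h1.2.symm.trans h2.2)]

/-- case: two affine points on a class line and an affine line -/
theorem eq_or_eq_aaca {i i' j i₀ : Fin n} {a a' b : Fin u} {s s' t : ZMod p}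
    (h1 : i = i₀) (h2 : i' = i₀) (h3 : π i j a = b ∧ φ i a j = s - t) (h4 : π i' j a' = b ∧ φ i' a' j = s' - t) :
    (LPt.aff i a s : LPt π φ) = LPt.aff i' a' s' ∨ (LLn.cls i₀ : LLn π φ) = LLn.aff j b t := by
  rcases eq_or_eq_aaac (π := π) (φ := φ) h3 h4 h1 h2 with h | h
  · exact Or.inl h
  · exact Or.inr h.symm

/-- case: an affine point and an axis point on two affine lines -/
theorem eq_or_eq_axaa {i j j' j₀ : Fin n} {a b b' : Fin u} {s t t' : ZMod p}
    (h1 : π i j a = b ∧ φ i a j = s - t) (h2 : j₀ = j) (h3 : π i j' a = b' ∧ φ i a j' = s - t') (h4 : j₀ = j') :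
    (LPt.aff i a s : LPt π φ) = LPt.ax j₀ ∨ (LLn.aff j b t : LLn π φ) = LLn.aff j' b' t' := by
  subst h2; subst h4
  right
  rw [h1.1.symm.trans h3.1, sub_right_inj.mp (h1.2.symm.trans h3.2)]

/-- case: an axis point and an affine point on two affine lines -/
theorem eq_or_eq_xaaa {i j j' j₀ : Fin n} {a b b' : Fin u} {s t t' : ZMod p}
    (h1 : j₀ = j) (h2 : π i j a = b ∧ φ i a j = s - t) (h3 : j₀ = j') (h4 : π i j' a = b' ∧ φ i a j' = s - t') :
    (LPt.ax j₀ : LPt π φ) = LPt.aff i a s ∨ (LLn.aff j b t : LLn π φ) = LLn.aff j' b' t' := by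
  rcases eq_or_eq_axaa (π := π) (φ := φ) h2 h1 h4 h3 with h | h
  · exact Or.inl h.symm
  · exact Or.inr h

/-- **Two points lie on at most one line** (the point half of the lift system). -/
theorem eq_or_eq_lift (hφ : LiftableZp π φ) {p₁ p₂ : LPt π φ} {l₁ l₂ : LLn π φ} (h1 : p₁ ∈ l₁) (h2 : p₂ ∈ l₁)
    (h3 : p₁ ∈ l₂) (h4 : p₂ ∈ l₂) : p₁ = p₂ ∨ l₁ = l₂ := by
  rcases p₁ with ⟨i, a, s⟩ | j₀ | _ <;> rcases p₂ with ⟨i', a', s'⟩ | j₀' | _ <;>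
    rcases l₁ with ⟨j, b, t⟩ | i₀ | _ <;> rcases l₂ with ⟨j', b', t'⟩ | i₀' | _
  all_goals
    simp only [aff_mem_aff, aff_mem_cls, aff_mem_axis, ax_mem_aff, ax_mem_cls, ax_mem_axis, ctr_mem_aff, ctr_mem_cls,
      ctr_mem_axis] at h1 h2 h3 h4
  all_goals first
    | exact Or.inl rfl
    | exact Or.inr rfl
    | exact eq_or_eq_aaaa hφ h1 h2 h3 h4
    | exact eq_or_eq_aaac h1 h2 h3 h4
    | exact eq_or_eq_aaca h1 h2 h3 h4
    | exact eq_or_eq_axaa h1 h2 h3 h4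
    | exact eq_or_eq_xaaa h1 h2 h3 h4
    | (refine Or.inr ?_; rw [← h1, ← h3]; done)
    | (refine Or.inr ?_; rw [← h2, ← h4]; done)
    | (refine Or.inl ?_; rw [h1, ← h2])
    | (refine Or.inl ?_; rw [h3, ← h4])

/-- the axis carries exactly the `n` axis points and the centre -/
theorem natCard_mem_axis : Nat.card {x : LPt π φ // x ∈ (LLn.axis : LLn π φ)} = n + 1 := by
  let e : {x : LPt π φ // x ∈ (LLn.axis : LLn π φ)} ≃ Option (Fin n) :=
    { toFun := fun x => match x with
        | ⟨.aff _ _ _, h⟩ => (h : False).elim | ⟨.ax j, _⟩ => some j | ⟨.ctr, _⟩ => none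
      invFun := fun o => match o with | some j => ⟨.ax j, trivial⟩ | none => ⟨.ctr, trivial⟩
      left_inv := by rintro ⟨⟨i, a, s⟩ | j | _, h⟩ <;> first | exact (h : False).elim | rfl
      right_inv := by rintro (_ | j) <;> rfl }
  rw [Nat.card_congr e, Nat.card_eq_fintype_card, Fintype.card_option, Fintype.card_fin]

/-- the sheet shift on points -/
def shiftPt : LPt π φ → LPt π φ
  | .aff i a s => .aff i a (s + 1) | .ax j => .ax j | .ctr => .ctr

/-- its inverse -/
def unshiftPt : LPt π φ → LPt π φ
  | .aff i a s => .aff i a (s - 1) | .ax j => .ax j | .ctr => .ctr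

/-- the sheet shift on lines -/
def shiftLn : LLn π φ → LLn π φ
  | .aff j b t => .aff j b (t + 1) | .cls i => .cls i | .axis => .axis

/-- its inverse -/
def unshiftLn : LLn π φ → LLn π φ
  | .aff j b t => .aff j b (t - 1) | .cls i => .cls i | .axis => .axis

/-- **The sheet shift is a collineation.** -/
def shift : Collineation (LPt π φ) (LLn π φ) where
  onPoints := ⟨shiftPt, unshiftPt, by rintro (⟨i, a, s⟩ | j | _) <;> simp [shiftPt, unshiftPt],
    by rintro (⟨i, a, s⟩ | j | _) <;> simp [shiftPt, unshiftPt]⟩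
  onLines := ⟨shiftLn, unshiftLn, by rintro (⟨j, b, t⟩ | i | _) <;> simp [shiftLn, unshiftLn],
    by rintro (⟨j, b, t⟩ | i | _) <;> simp [shiftLn, unshiftLn]⟩
  mem_iff := by
    rintro (⟨i, a, s⟩ | j | _) (⟨j', b, t⟩ | i' | _) <;> simp [shiftPt, shiftLn, add_sub_add_right_eq_sub]

/-- powers of the shift move the sheet index -/
theorem shift_pow_aff (k : ℕ) (i : Fin n) (a : Fin u) (s : ZMod p) :
    ((shift : Collineation (LPt π φ) (LLn π φ)).onPoints ^ k) (LPt.aff i a s) = LPt.aff i a (s + (k : ZMod p)) := by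
  induction k with
  | zero => simp
  | succ k ih =>
    rw [pow_succ', Equiv.Perm.mul_apply, ih]
    show LPt.aff i a (s + (k : ZMod p) + 1) = _
    congr 1; push_cast; ring

/-- `shift ^ p = 1` -/
theorem shift_pow_p : (shift : Collineation (LPt π φ) (LLn π φ)).onPoints ^ p = 1 := by
  ext x
  rcases x with ⟨i, a, s⟩ | j | _
  · rw [shift_pow_aff, ZMod.natCast_self, add_zero]; rfl
  · rw [Summit.Ventures.DiscreteObjects.Hadamard.perm_pow_apply_of_fixed _ (rfl : shift.onPoints (LPt.ax j) = _)]; rfl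
  · rw [Summit.Ventures.DiscreteObjects.Hadamard.perm_pow_apply_of_fixed _ (rfl : shift.onPoints LPt.ctr = _)]; rfl

/-- `shift ≠ 1` -/
theorem shift_ne_one (hn' : 0 < n) (hu : 0 < u) (hp : 1 < p) :
    (shift : Collineation (LPt π φ) (LLn π φ)).onPoints ≠ 1 := by
  intro h
  have h' := congrArg (fun τ : Equiv.Perm (LPt π φ) => τ (LPt.aff ⟨0, hn'⟩ ⟨0, hu⟩ 0)) h
  have h'' : (LPt.aff ⟨0, hn'⟩ ⟨0, hu⟩ (0 + 1) : LPt π φ) = LPt.aff ⟨0, hn'⟩ ⟨0, hu⟩ 0 := h'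
  simp only [LPt.aff.injEq, true_and, zero_add] at h''
  haveI : Fact (1 < p) := ⟨hp⟩
  exact one_ne_zero h''

/-- the shift fixes every point of the axis -/
theorem shift_isAxis : (shift : Collineation (LPt π φ) (LLn π φ)).IsAxis LLn.axis := by
  rintro (⟨i, a, s⟩ | j | _) h
  · exact (h : False).elim
  · rfl
  · rfl

/-- the shift fixes every line through the centre -/
theorem shift_isCenter : (shift : Collineation (LPt π φ) (LLn π φ)).IsCenter LPt.ctr := by
  rintro (⟨j, b, t⟩ | i | _) h
  · exact (h : False).elim
  · rfl
  · rfl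

variable [NeZero p]

/-- the points of the lift as a sum type (finiteness) -/
def LPt.equivSum : LPt π φ ≃ (Fin n × Fin u × ZMod p) ⊕ Fin n ⊕ Unit where
  toFun x := match x with
    | .aff i a s => Sum.inl (i, a, s) | .ax j => Sum.inr (Sum.inl j) | .ctr => Sum.inr (Sum.inr ())
  invFun y := match y with
    | Sum.inl (i, a, s) => .aff i a s | Sum.inr (Sum.inl j) => .ax j | Sum.inr (Sum.inr _) => .ctr
  left_inv := by rintro (⟨i, a, s⟩ | j | _) <;> rfl
  right_inv := by rintro (⟨i, a, s⟩ | j | ⟨⟩) <;> rfl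

/-- the lines of the lift as a sum type (finiteness) -/
def LLn.equivSum : LLn π φ ≃ (Fin n × Fin u × ZMod p) ⊕ Fin n ⊕ Unit where
  toFun x := match x with
    | .aff j b t => Sum.inl (j, b, t) | .cls i => Sum.inr (Sum.inl i) | .axis => Sum.inr (Sum.inr ())
  invFun y := match y with
    | Sum.inl (j, b, t) => .aff j b t | Sum.inr (Sum.inl i) => .cls i | Sum.inr (Sum.inr _) => .axis
  left_inv := by rintro (⟨j, b, t⟩ | i | _) <;> rfl
  right_inv := by rintro (⟨j, b, t⟩ | i | ⟨⟩) <;> rfl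

/-- the points of the lift form a finite type -/
instance : Fintype (LPt π φ) := Fintype.ofEquiv _ LPt.equivSum.symm

/-- the lines of the lift form a finite type -/
instance : Fintype (LLn π φ) := Fintype.ofEquiv _ LLn.equivSum.symm

/-- the differences `φ(X,B) - φ(Y,B)` over the common blocks of two points of different classes exhaust `ZMod p` -/
theorem exists_common_block (hπ : IsSTD p π) (hφ : LiftableZp π φ) {i i' : Fin n} (hii' : i ≠ i') (a a' : Fin u)
    (v : ZMod p) : ∃ j, π i j a = π i' j a' ∧ φ i a j - φ i' a' j = v := by
  set J := univ.filter fun j => π i j a = π i' j a' with hJ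
  have hcard : J.card = p := hπ.1 i i' hii' a a'
  have hinj : Set.InjOn (fun j => φ i a j - φ i' a' j) J := by
    intro j₁ hj₁ j₂ hj₂ h
    by_contra hne
    exact hφ.1 i i' hii' a a' j₁ j₂ hne (mem_filter.mp hj₁).2 (mem_filter.mp hj₂).2 h
  have himg : (J.image fun j => φ i a j - φ i' a' j) = univ := by
    apply eq_univ_of_card
    rw [card_image_of_injOn hinj, hcard, ZMod.card]
  have hv : v ∈ J.image fun j => φ i a j - φ i' a' j := by rw [himg]; exact mem_univ v
  obtain ⟨j, hj, hjv⟩ := mem_image.mp hv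
  exact ⟨j, (mem_filter.mp hj).2, hjv⟩

/-- **Two distinct points of the lift lie on a common line.** -/
theorem exists_join (hπ : IsSTD p π) (hφ : LiftableZp π φ) (x y : LPt π φ) (hxy : x ≠ y) :
    ∃ m : LLn π φ, x ∈ m ∧ y ∈ m := by
  rcases x with ⟨i, a, s⟩ | j | _ <;> rcases y with ⟨i', a', s'⟩ | j' | _
  · by_cases hii' : i = i'
    · exact ⟨LLn.cls i, by simp, by simp [hii']⟩
    obtain ⟨j, hj, hd⟩ := exists_common_block hπ hφ hii' a a' (s - s')
    refine ⟨LLn.aff j (π i j a) (s - φ i a j), by rw [aff_mem_aff]; exact ⟨rfl, by ring⟩, ?_⟩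
    rw [aff_mem_aff]
    refine ⟨hj.symm, ?_⟩
    linear_combination -hd
  · exact ⟨LLn.aff j' (π i j' a) (s - φ i a j'), by rw [aff_mem_aff]; exact ⟨rfl, by ring⟩, by simp⟩
  · exact ⟨LLn.cls i, by simp, by simp⟩
  · exact ⟨LLn.aff j (π i' j a') (s' - φ i' a' j), by simp, by rw [aff_mem_aff]; exact ⟨rfl, by ring⟩⟩
  · exact ⟨LLn.axis, by simp, by simp⟩
  · exact ⟨LLn.axis, by simp, by simp⟩
  · exact ⟨LLn.cls i', by simp, by simp⟩
  · exact ⟨LLn.axis, by simp, by simp⟩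
  · exact absurd rfl hxy

/-- points and lines of the lift are equinumerous -/
theorem card_LPt_eq_card_LLn : Fintype.card (LPt π φ) = Fintype.card (LLn π φ) := by
  let e : LPt π φ ≃ LLn π φ :=
    { toFun := fun x => match x with | .aff i a s => .aff i a s | .ax j => .cls j | .ctr => .axis
      invFun := fun m => match m with | .aff j b t => .aff j b t | .cls i => .ax i | .axis => .ctr
      left_inv := by rintro (⟨i, a, s⟩ | j | _) <;> rfl
      right_inv := by rintro (⟨j, b, t⟩ | i | _) <;> rfl }
  exact Fintype.card_congr e

/-- the lift has lines through any two points (and is nondegenerate) -/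
@[reducible] noncomputable def liftedHasLines (hπ : IsSTD p π) (hφ : LiftableZp π φ) (hn : 2 ≤ n) (hu : 0 < u) :
    HasLines (LPt π φ) (LLn π φ) where
  exists_point := by
    rintro (⟨j, b, t⟩ | i | _)
    · exact ⟨LPt.ctr, by simp⟩
    · exact ⟨LPt.ax ⟨0, by omega⟩, by simp⟩
    · exact ⟨LPt.aff ⟨0, by omega⟩ ⟨0, hu⟩ 0, by simp⟩
  exists_line := by
    rintro (⟨i, a, s⟩ | j | _)
    · exact ⟨LLn.axis, by simp⟩
    · exact ⟨LLn.cls ⟨0, by omega⟩, by simp⟩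
    · exact ⟨LLn.aff ⟨0, by omega⟩ ⟨0, hu⟩ 0, by simp⟩
  eq_or_eq := fun h1 h2 h3 h4 => eq_or_eq_lift hφ h1 h2 h3 h4
  mkLine := fun {x y} h => Classical.choose (exists_join hπ hφ x y h)
  mkLine_ax := fun {x y} h => Classical.choose_spec (exists_join hπ hφ x y h)

/-- **The lift is a projective plane.** -/
@[reducible] noncomputable def liftedPlane (hπ : IsSTD p π) (hφ : LiftableZp π φ) (hn : 2 ≤ n) (hu : 0 < u) :
    ProjectivePlane (LPt π φ) (LLn π φ) :=
  let hL : HasLines (LPt π φ) (LLn π φ) := liftedHasLines hπ hφ hn hu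
  let hP : HasPoints (LPt π φ) (LLn π φ) := @HasLines.hasPoints _ _ _ hL _ _ card_LPt_eq_card_LLn
  { hP, hL with
    exists_config := by
      refine ⟨LPt.aff ⟨0, by omega⟩ ⟨0, hu⟩ 0, LPt.ctr, LPt.ax ⟨0, by omega⟩,
        LLn.aff ⟨1, by omega⟩ ⟨0, hu⟩ 0, LLn.axis, LLn.cls ⟨1, by omega⟩, ?_, ?_, ?_, ?_, ?_, ?_, ?_, ?_⟩ <;>
        simp [Fin.ext_iff] }

/-- **The lift has order `n`.** -/
theorem order_liftedPlane (hπ : IsSTD p π) (hφ : LiftableZp π φ) (hn : 2 ≤ n) (hu : 0 < u) :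
    @ProjectivePlane.order (LPt π φ) (LLn π φ) _ (liftedPlane hπ hφ hn hu) = n := by
  letI := liftedPlane hπ hφ hn hu
  have h : Nat.card {x : LPt π φ // x ∈ (LLn.axis : LLn π φ)} = ProjectivePlane.order (LPt π φ) (LLn π φ) + 1 :=
    ProjectivePlane.pointCount_eq (LPt π φ) (LLn.axis : LLn π φ)
  rw [natCard_mem_axis] at h
  omega

end Lift

end ZpLift

/-! ### Decidability and the smallest control: STD₃[3;1] with voltage `i·j` lifts to the plane of order 3 -/

set_option synthInstance.maxSize 2048 in
/-- `LiftableZp` is decidable on explicit data. -/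
instance decLiftableZp {k u p : ℕ} (π : IncArray k u) (φ : Fin k → Fin u → Fin k → ZMod p) :
    Decidable (LiftableZp π φ) := by
  unfold LiftableZp; infer_instance

/-- the trivial STD₃[3;1] -/
def std31 : IncArray 3 1 := fun _ _ => 1

/-- the voltage `φ(i, j) = i · j` over `ZMod 3` (a field: differences `(i - i') j` are distinct) -/
def volt31 : Fin 3 → Fin 1 → Fin 3 → ZMod 3 := fun i _ j => (i.val * j.val : ℕ)

/-- **(+) control of the `ZMod p` lift machinery:** `(std31, volt31)` is a liftable STD₃[3;1] (kernel `decide`) and its lift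
is a projective plane of order 3 (13 points). -/
theorem exists_plane_order_three :
    ∃ _inst : ProjectivePlane (ZpLift.LPt std31 volt31) (ZpLift.LLn std31 volt31),
      ProjectivePlane.order (ZpLift.LPt std31 volt31) (ZpLift.LLn std31 volt31) = 3 :=
  have hπ : IsSTD 3 std31 := by decide
  have hφ : LiftableZp std31 volt31 := by decide
  ⟨ZpLift.liftedPlane hπ hφ (by norm_num) Nat.one_pos, ZpLift.order_liftedPlane hπ hφ (by norm_num) Nat.one_pos⟩

/-! ### PP(12): the elation-of-order-3 cell is a finite array statement -/

/-- **Census statement (typed, a theorem IN PRINT — Janko–van Trung 1981 —, not re-derived here):** no projective plane of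
order 12 admits a non-trivial elation `σ` with `σ³ = 1`. -/
def NoElationOrder3Order12 : Prop :=
  ∀ (P L : Type) [Membership P L] [Fintype P] [Fintype L] [ProjectivePlane P L],
    ProjectivePlane.order P L = 12 → ∀ (σ : Collineation P L) (l : L) (c : P),
      σ.IsAxis l → σ.IsCenter c → c ∈ l → σ.onPoints ^ 3 = 1 → σ.onPoints = 1

/-- **Finite array statement (typed, NOT decided):** no STD₃[12;4] incidence array admits a `ZMod 3` voltage solving the lift
system. -/
def NoLiftableSTD3_12_4 : Prop :=
  ∀ π : IncArray 12 4, IsSTD 3 π → ∀ φ : Fin 12 → Fin 4 → Fin 12 → ZMod 3, ¬ LiftableZp π φ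

/-- **The elation-of-order-3 cell of PP(12) IS the finite array statement (kernel equivalence).** -/
theorem noElationOrder3_iff_noLiftableSTD3 : NoElationOrder3Order12 ↔ NoLiftableSTD3_12_4 := by
  constructor
  · intro h π hπ φ hφ
    letI := ZpLift.liftedPlane hπ hφ (by norm_num) (by norm_num)
    have h12 := ZpLift.order_liftedPlane hπ hφ (by norm_num) (by norm_num)
    exact ZpLift.shift_ne_one (π := π) (φ := φ) (by norm_num) (by norm_num) (by norm_num)
      (h _ _ h12 ZpLift.shift ZpLift.LLn.axis ZpLift.LPt.ctr ZpLift.shift_isAxis ZpLift.shift_isCenter trivial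
        ZpLift.shift_pow_p)
  · intro h P L _ _ _ _ h12 σ l c hl hc hcl hq
    classical
    exact σ.noElationOrder3_of_no_liftableZ3 h h12 hl hc hcl hq

end Summit.Ventures.DiscreteObjects.PP12
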